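import Summits.NavierStokesRegularity.FluidComputer.LerayDeadline
import Summits.NavierStokesRegularity.FluidComputer.CriticalDatumFloor
import HarnessLib

/-!
# Fluid computer — the level dictionary READ AT THE DATUM (L35): what a blow-up candidate `(ν, u₀, T)` must
# already satisfy at time zero

HONEST FRAMING (cell `pub-fluidc`, verbatim): *low prior, high value-of-information experiment on Tao's
machine paradigm; NOT a claim that NS blows up.* Theorem side of the cell; nothing here is evidence of blow-up.
The cell DESIGNS initial data. Most dictionary entries speak about interior instants or terminal windows; this
module collects what they say AT `t = 0`, i.e. the tests a candidate triple (viscosity `ν`, datum `u₀ = u(0)`,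
claimed lifespan `T`) must pass before any dynamics. For every maximal smooth solution `(u, p)` of the unforced
Navier–Stokes system on `ℝ³ × [0, T)` (`ν > 0`) which is Leray–Hopf from `u 0`:

* `datum_face` — absolute constants `c₁, c₂, δ > 0` with
  (Z) `c₁ν³ ≤ Z(0)² · T`, `Z(0) = ∫|∇u₀|²` — to blow up by time `T` the datum needs enstrophy `≥ √(c₁ν³/T)`
  (`LerayClock.enstrophy_clock` at `t = 0`; trivial if `Z(0) = ∞`);
  (E) `4c₂ν⁵ · T ≤ ‖u₀‖₂⁴` — the lifespan is at most `‖u₀‖₂⁴/(4c₂ν⁵)` (`LerayDeadline.lifespan_le`);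
  (P) `4c₁c₂ν⁸ ≤ Z(0)² · ‖u₀‖₂⁴` — the SCALE-INVARIANT product `‖u₀‖₂² Z(0) ≥ 2√(c₁c₂) ν⁴` ((Z) × (E): the datum is
  never globally small);
  (K) if `u₀` is bounded, `δν < ‖u₀‖_{L³}` — Kato's floor at the datum (`CriticalDatumFloor.eLpNorm_three_floor'`).
* `datum_eHomSobolevSeminorm_half_floor` — (H) if `u₀` is bounded, `δ'ν < ‖u₀‖_{Ḣ^{1/2}}` (Fujita–Kato's currency, by
  the critical embedding `eLpNorm_three_le_eHomSobolevSeminorm_half_holds`).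

Reading for the atlas (words): a designed field `u₀` run at viscosity `ν` can only be a blow-up candidate with
lifespan `T` if its energy, enstrophy and critical norms clear these floors; (P), (K), (H) are scale-free and do
not involve `T`. HONEST SIZE NOTE: `c₁, c₂, δ, δ'` inexplicit — the tests are SHAPES (`‖u₀‖₂²Z(0) ≳ ν⁴`,
`‖u₀‖₃ ≳ ν`), and for the cell's order-one designs at `ν ≈ 10⁻²–10⁻³` they are passed with room to spare: the
datum face constrains SMALL data, it does not certify large ones. Necessity only. 0 sorry; no new definitions,
no named facts.

## References

* J. Leray, Acta Math. 63 (1934) 193–248, §20, §34. [Leray1934]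
* T. Kato, Math. Z. 187 (1984) 471–480, Thms. 2 and 4. [Kato1984MathZ]
* J. C. Robinson, J. L. Rodrigo, W. Sadowski, CUP 2016, Lemma 6.11. [RobinsonRodrigoSadowski2016]
* H. Bahouri, J.-Y. Chemin, R. Danchin, Springer 2011, Thm. 1.38. [BahouriCheminDanchin2011]
-/

noncomputable section

open MeasureTheory Set Function Filter Topology Metric
open scoped ENNReal NNReal
open Literature.Analysis.FluidPDE Literature.Analysis.FunctionSpaces
open Summit.NavierStokesRegularity.FluidComputer.LerayClock
open Summit.NavierStokesRegularity.FluidComputer.LerayDeadline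
open Summit.NavierStokesRegularity.FluidComputer.CriticalDatumFloor

namespace Summit.NavierStokesRegularity.FluidComputer.DatumFace

/-- **L35 — THE DICTIONARY AT THE DATUM.** There are absolute constants `c₁, c₂, δ > 0` such that for every
`ν > 0`, `T > 0` and every maximal smooth solution `(u, p)` of the unforced Navier–Stokes system on `ℝ³ × [0, T)`
which is Leray–Hopf from `u 0`: (Z) `c₁ν³ ≤ (∫|∇u(0)|²)² · T` (in `[0,∞]`); (E) `4c₂ν⁵ T ≤ ‖u(0)‖₂⁴`;
(P) `4c₁c₂ν⁸ ≤ (∫|∇u(0)|²)² · ‖u(0)‖₂⁴` (in `[0,∞]`); (K) if `‖u(0, x)‖ ≤ B₀` for all `x` then `δν < ‖u(0)‖_{L³}`.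
(`LerayClock.enstrophy_clock` and `LerayDeadline.lifespan_le` at `t = 0`, their product, and
`CriticalDatumFloor.eLpNorm_three_floor'`.) [cite: Leray1934, §20 and §34] [cite: Kato1984MathZ, Thms. 2 and 4]
[cite: RobinsonRodrigoSadowski2016, Lemma 6.11] -/
theorem datum_face :
    ∃ c₁ c₂ δ : ℝ, 0 < c₁ ∧ 0 < c₂ ∧ 0 < δ ∧ ∀ (ν T : ℝ), 0 < ν → 0 < T →
      ∀ (u : ℝ → EuclideanSpace ℝ (Fin 3) → EuclideanSpace ℝ (Fin 3)) (p : ℝ → EuclideanSpace ℝ (Fin 3) → ℝ),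
      IsMaximalSmoothSolution ν 0 u p T → IsLerayHopfOn T ν 0 (u 0) u →
      ENNReal.ofReal (c₁ * ν ^ 3) ≤
          (∫⁻ x, ENNReal.ofReal (frobeniusNormSq (fderiv ℝ (u 0) x))) ^ 2 * ENNReal.ofReal T ∧
      4 * c₂ * ν ^ 5 * T ≤ (eLpNorm (u 0) 2 volume).toReal ^ 4 ∧
      ENNReal.ofReal (4 * c₁ * c₂ * ν ^ 8) ≤
          (∫⁻ x, ENNReal.ofReal (frobeniusNormSq (fderiv ℝ (u 0) x))) ^ 2 * eLpNorm (u 0) 2 volume ^ 4 ∧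
      ((∃ B₀ : ℝ, ∀ x, ‖u 0 x‖ ≤ B₀) → ENNReal.ofReal (δ * ν) < eLpNorm (u 0) 3 volume) := by
  obtain ⟨c₁, hc₁, H₁⟩ := enstrophy_clock
  obtain ⟨c₂, hc₂, H₂⟩ := lifespan_le
  obtain ⟨δ, hδ, H₃⟩ := eLpNorm_three_floor'
  refine ⟨c₁, c₂, δ, hc₁, hc₂, hδ, fun ν T hν hT u p hmax hLH => ?_⟩
  have hZ := H₁ ν T hν hT u p hmax hLH 0 ⟨le_rfl, hT⟩
  rw [sub_zero] at hZ
  have hE := H₂ ν T hν hT u p hmax hLH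
  have hK := (H₃ ν T hν hT u p hmax hLH).2
  refine ⟨hZ, hE, ?_, hK⟩
  -- (P) = (Z) × (E)
  set Z₀ : ℝ≥0∞ := ∫⁻ x, ENNReal.ofReal (frobeniusNormSq (fderiv ℝ (u 0) x)) with hZ₀
  have hu0 : MemLp (u 0) 2 volume := hLH.memLp 0 ⟨le_rfl, hT.le⟩
  have h4 : 0 ≤ 4 * c₂ * ν ^ 5 := by positivity
  have hE' : ENNReal.ofReal (4 * c₂ * ν ^ 5 * T) ≤ eLpNorm (u 0) 2 volume ^ 4 := by
    calc ENNReal.ofReal (4 * c₂ * ν ^ 5 * T) ≤ ENNReal.ofReal ((eLpNorm (u 0) 2 volume).toReal ^ 4) :=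
          ENNReal.ofReal_le_ofReal hE
      _ = eLpNorm (u 0) 2 volume ^ 4 := by
          rw [ENNReal.ofReal_pow ENNReal.toReal_nonneg, ENNReal.ofReal_toReal hu0.eLpNorm_ne_top]
  calc ENNReal.ofReal (4 * c₁ * c₂ * ν ^ 8)
      = ENNReal.ofReal (c₁ * ν ^ 3) * ENNReal.ofReal (4 * c₂ * ν ^ 5) := by
        rw [← ENNReal.ofReal_mul (by positivity)]
        congr 1
        ring
    _ ≤ Z₀ ^ 2 * ENNReal.ofReal T * ENNReal.ofReal (4 * c₂ * ν ^ 5) := mul_le_mul' hZ le_rfl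
    _ = Z₀ ^ 2 * ENNReal.ofReal (4 * c₂ * ν ^ 5 * T) := by
        rw [mul_assoc, ← ENNReal.ofReal_mul hT.le]
        congr 2
        ring
    _ ≤ Z₀ ^ 2 * eLpNorm (u 0) 2 volume ^ 4 := mul_le_mul' le_rfl hE'

/-- **L35 (H) — Fujita–Kato's currency at the datum.** There is an absolute `δ' > 0` such that for every maximal
smooth Leray–Hopf solution of the unforced system (`ν > 0`) with BOUNDED datum: `δ'ν < ‖u(0)‖_{Ḣ^{1/2}}` (the
tree's `Function.eHomSobolevSeminorm (1/2)` of the complexified datum). From (K) and the critical embedding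
`‖f‖_{L³} ≤ C‖f‖_{Ḣ^{1/2}}` (`eLpNorm_three_le_eHomSobolevSeminorm_half_holds`), `δ' = δ/(C + 1)`.
[cite: BahouriCheminDanchin2011, Thm. 1.38] [cite: Kato1984MathZ, Thms. 2 and 4] -/
theorem datum_eHomSobolevSeminorm_half_floor :
    ∃ δ' : ℝ, 0 < δ' ∧ ∀ (ν T : ℝ), 0 < ν → 0 < T →
      ∀ (u : ℝ → EuclideanSpace ℝ (Fin 3) → EuclideanSpace ℝ (Fin 3)) (p : ℝ → EuclideanSpace ℝ (Fin 3) → ℝ),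
      IsMaximalSmoothSolution ν 0 u p T → IsLerayHopfOn T ν 0 (u 0) u →
      (∃ B₀ : ℝ, ∀ x, ‖u 0 x‖ ≤ B₀) →
        ENNReal.ofReal (δ' * ν) < Function.eHomSobolevSeminorm (1 / 2 : ℝ) (EuclideanSpace.complexify ∘ u 0) := by
  obtain ⟨δ, hδ, H⟩ := eLpNorm_three_floor'
  obtain ⟨C, hC⟩ := @Literature.Analysis.FunctionSpaces.eLpNorm_three_le_eHomSobolevSeminorm_half_holds
    (EuclideanSpace ℂ (Fin 3)) _ _ _
  have hC1 : (0 : ℝ) < C + 1 := by positivity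
  refine ⟨δ / (C + 1), div_pos hδ hC1, fun ν T hν hT u p hmax hLH hbd => ?_⟩
  have hfloor := (H ν T hν hT u p hmax hLH).2 hbd
  set S : ℝ≥0∞ := Function.eHomSobolevSeminorm (1 / 2 : ℝ) (EuclideanSpace.complexify ∘ u 0) with hS
  have h2 : MemLp (EuclideanSpace.complexify ∘ u 0) 2 volume :=
    memLp_complexify_comp (hLH.memLp 0 ⟨le_rfl, hT.le⟩)
  have hnorm : eLpNorm (u 0) 3 volume = eLpNorm (EuclideanSpace.complexify ∘ u 0) 3 volume :=
    eLpNorm_congr_norm_ae (Eventually.of_forall fun x => (EuclideanSpace.norm_complexify (u 0 x)).symm)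
  have hemb : eLpNorm (u 0) 3 volume ≤ ((C + 1 : ℝ≥0) : ℝ≥0∞) * S := by
    rw [hnorm]
    refine (hC _ h2).trans (mul_le_mul' ?_ le_rfl)
    exact_mod_cast le_add_of_nonneg_right zero_le_one
  have hlt : ENNReal.ofReal (δ * ν) < ((C + 1 : ℝ≥0) : ℝ≥0∞) * S := hfloor.trans_le hemb
  have hC1' : ((C + 1 : ℝ≥0) : ℝ≥0∞) ≠ 0 := by exact_mod_cast hC1.ne'
  have hC1top : ((C + 1 : ℝ≥0) : ℝ≥0∞) ≠ ⊤ := ENNReal.coe_ne_top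
  have hdiv : ENNReal.ofReal (δ / (C + 1) * ν) = ENNReal.ofReal (δ * ν) / ((C + 1 : ℝ≥0) : ℝ≥0∞) := by
    rw [div_mul_eq_mul_div, ENNReal.ofReal_div_of_pos hC1]
    congr 1
    rw [ENNReal.ofReal_add (NNReal.coe_nonneg C) zero_le_one, ENNReal.ofReal_coe_nnreal, ENNReal.ofReal_one]
    push_cast
    rfl
  rw [hdiv, ENNReal.div_lt_iff (Or.inl hC1') (Or.inl hC1top)]
  exact hlt.trans_eq (mul_comm _ _)

end Summit.NavierStokesRegularity.FluidComputer.DatumFace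

end
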